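import Literature.NumberTheory.EllipticCurves.IwasawaEulerCharProofs
import Mathlib.RingTheory.LocalRing.Module
import Mathlib.FieldTheory.Finiteness
import HarnessLib

/-!
# LEMMA M₀ (route M of sub-cell `eisenstein-p1`, in the kernel): a finitely generated torsion
# `Λ`-module without nonzero finite submodules is generated by at most `v_p(f(0))` elements

HONEST FRAMING (cell `b2b-bsdres`, run/shared/lean/b2b/bsd-rank1-residual/, verbatim in every
file): the goal of the cell is to DELETE the COMBINATION-SHAPED residual classes of the
Birch–Swinnerton-Dyer formula for ALL analytic-rank `≤ 1` elliptic curves over `ℚ` — "full BSD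
formula for every rank `≤ 1` curve in class `C`" assembled STRICTLY from published theorems — so
that the rank-`≤ 1` remainder becomes exactly the CONSTRUCTION-SHAPED classes, which are TYPED
(missing-input `Prop`s), NOT attempted. This is not "finishing BSD". Sub-cell
`b2b-bsdres-eisenstein-p1` (CLASS-OWNERS row "X1 (r=0)"), gen 13: research route; NO CLAIM BEYOND
STATED CLASSES; nothing here changes a label. THEOREMS ONLY (generic commutative algebra over the
Iwasawa algebra `Λ = ℤ_p⟦T⟧ = IwasawaAlgebra p`); no definition, no named fact.

WHAT THIS FILE PROVES. Route M (X1R0-GAPMAP §21; kernel form `X1/GeneratorSqueeze.lean`) rests on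
ONE unprinted step, LEMMA (M) of §21.1: for a finitely generated torsion `Λ`-module `X` WITHOUT
nonzero finite `Λ`-submodules and `char(X) = (f)`, the minimal number of generators
`d(X) = dim_{𝔽_p} X/𝔪X` is at most `ord_𝔪(f)`. This file puts its LAYER-0 form **(M₀)** in the
kernel, with the weight `v_p(f(0))` (`≥ ord_𝔪(f)`, and EQUAL to it whenever the distinguished
polynomial of `f` has all its roots of valuation `< 1` or `= 1` — the Eisenstein-type shapes through
which route M bites, §21.2 "WHERE IT BITES"):

**(M₀)** `X` finitely generated torsion over `Λ`, every finite `Λ`-submodule of `X` is `0`,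
`char(X) = (f)`, `f(0) ≠ 0`. Then `X[T] = 0`, `#(X/TX) = p^{e(X)}` with `v_p(f(0)) = e(X)`
(`e` = the tree's `Γ`-Euler-characteristic exponent `IwasawaAlgebra.eulerExp`), hence
`#(X/𝔪X) ≤ p^{v_p(f(0))}` and `X` is generated by at most `v_p(f(0))` elements.

PROOF (all over tree theorems of `Literature/NumberTheory/EllipticCurves/IwasawaEulerCharProofs.lean`,
Greenberg LNM 1716 §4 Lemma 4.2 / proof of Thm. 4.1 as formalised there): `f(0) ≠ 0` iff
`ord_T f = 0` iff `ℓ_{(T)}(X) = 0` (`order_eq_toNat_lengthAt`); then the dévissage theorem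
`card_coinvariants_of_lengthAt_eq_zero` gives `X[T]`, `X/TX` finite with
`#(X/TX) = #X[T] · p^{e(X)}`; `X[T]` is a finite `Λ`-submodule, so it is `0` by hypothesis;
`coeff_0 f = U · p^{e(X)}` (`coeff_lengthAt_charGenerator_eq_unit_mul_pow`) gives `v_p(f(0)) = e(X)`;
`X/𝔪X` is a quotient of `X/TX` (`(T) ≤ 𝔪 = (p, T)`); and Nakayama over the local ring `Λ`
(`IsLocalRing.map_mkQ_eq_top`) turns an `𝔽_p`-basis of `X/𝔪X` (at most `v_p(f(0))` vectors, since
`#Λ/𝔪 = p`) into a generating set of `X`.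

WHY `v_p(f(0))` AND NOT `ord_𝔪(f)`. For `f = p^μ · P · u` with `P` distinguished, roots `r_i`:
`v_p(f(0)) = μ + Σ_i v(r_i)` while `ord_𝔪(f) = μ + Σ_i min(1, v(r_i))` (§21.1); they agree unless
`P` has a root of valuation `> 1`. The sharper `ord_𝔪` form needs either the Fitting-ideal
argument of §21.1 (`Fitt = char` at projective dimension `≤ 1`: not in Mathlib) or the same (M₀)
after the substitution `T ↦ T − pa` (a continuous automorphism of `Λ`; transport of `charIdeal`
not in the tree) — recorded as the remaining paper step; the census split (how many route-M
closures need only (M₀)) is in X1R0-GAPMAP §22.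

* `lengthAt_primeT_eq_zero_of_constantCoeff_ne_zero` — `f(0) ≠ 0 ⇒ ℓ_{(T)}(X) = 0`.
* `invariants_eq_bot` — `X[T] = 0`.
* `natCard_coinvariants_eq` — `#(X/TX) = p^{e(X)}`; `valuation_constantCoeff_eq_eulerExp` —
  `v_p(f(0)) = e(X)`.
* **`natCard_quotient_maximalIdeal_le`** — `#(X/𝔪X) ≤ p^{v_p(f(0))}` (LEMMA M₀, count form).
* **`exists_finset_span_eq_top_card_le`** — `X` is generated by `≤ v_p(f(0))` elements
  (LEMMA M₀, generator form).

References: [GreenbergLNM1716] §4 (Lemma 4.2, proof of Thm. 4.1), p. 137; X1R0-GAPMAP §21.1, §22.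
-/

noncomputable section

open scoped Classical

open Literature.NumberTheory.EllipticCurves Literature.NumberTheory.EllipticCurves.IwasawaAlgebra
  IsLocalRing

universe u

set_option autoImplicit false

namespace Summit.BirchSwinnertonDyer.Rank1Residual.X1.GeneratorBound

variable {p : ℕ} [Fact p.Prime] (M : Type u) [AddCommGroup M] [Module (IwasawaAlgebra p) M]
  [Module.Finite (IwasawaAlgebra p) M]

/-! ## §1. `f(0) ≠ 0` means `ℓ_{(T)}(X) = 0` -/

/-- For `X` finitely generated torsion with `char(X) = (f)`: `f(0) ≠ 0 ⇒ ℓ_{(T)}(X) = 0`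
(`ord_T f = ℓ_{(T)}(X)`, tree `order_eq_toNat_lengthAt`). [cite: Washington1997, §13.2] -/
theorem lengthAt_primeT_eq_zero_of_constantCoeff_ne_zero
    (hM : Module.IsTorsion (IwasawaAlgebra p) M) (f : IwasawaAlgebra p)
    (hf : Module.charIdeal (IwasawaAlgebra p) M = Ideal.span {f})
    (h0 : PowerSeries.constantCoeff f ≠ 0) :
    Module.lengthAt (IwasawaAlgebra p) M (primeT p) = 0 := by
  have hord : f.order = ((Module.lengthAt (IwasawaAlgebra p) M (primeT p)).toNat : ℕ∞) :=
    order_eq_toNat_lengthAt p hM f hf (primeT p) (primeT_asIdeal p)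
  have hne : Module.lengthAt (IwasawaAlgebra p) M (primeT p) ≠ ⊤ :=
    lengthAt_primeT_ne_top M hM
  have h0' : f.order = 0 := by
    by_contra hne0
    exact h0 (PowerSeries.order_ne_zero_iff_constCoeff_eq_zero.mp hne0)
  rw [h0'] at hord
  have : (Module.lengthAt (IwasawaAlgebra p) M (primeT p)).toNat = 0 := by exact_mod_cast hord.symm
  rcases (ENat.toNat_eq_zero.mp this) with h | h
  · exact h
  · exact absurd h hne

/-! ## §2. `X[T] = 0` and `#(X/TX) = p^{e(X)}` -/

/-- **`X[T] = 0`** for `X` finitely generated torsion WITHOUT nonzero finite `Λ`-submodules,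
`char(X) = (f)`, `f(0) ≠ 0`: `X[T]` is finite by the `Γ`-Euler-characteristic dévissage
(`card_coinvariants_of_lengthAt_eq_zero`), hence `0`. [cite: GreenbergLNM1716, §4 Lemma 4.2] -/
theorem invariants_eq_bot (hM : Module.IsTorsion (IwasawaAlgebra p) M)
    (hnf : ∀ N : Submodule (IwasawaAlgebra p) M, Finite N → N = ⊥) (f : IwasawaAlgebra p)
    (hf : Module.charIdeal (IwasawaAlgebra p) M = Ideal.span {f})
    (h0 : PowerSeries.constantCoeff f ≠ 0) : invariants p M = ⊥ := by
  obtain ⟨hfin, -, -⟩ := card_coinvariants_of_lengthAt_eq_zero M hM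
    (lengthAt_primeT_eq_zero_of_constantCoeff_ne_zero M hM f hf h0)
  exact hnf _ hfin

/-- **`#(X/TX) = p^{e(X)}`** (and `X/TX` is finite) under the same hypotheses.
[cite: GreenbergLNM1716, §4 Lemma 4.2 and proof of Thm. 4.1] -/
theorem natCard_coinvariants_eq (hM : Module.IsTorsion (IwasawaAlgebra p) M)
    (hnf : ∀ N : Submodule (IwasawaAlgebra p) M, Finite N → N = ⊥) (f : IwasawaAlgebra p)
    (hf : Module.charIdeal (IwasawaAlgebra p) M = Ideal.span {f})
    (h0 : PowerSeries.constantCoeff f ≠ 0) :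
    Finite (coinvariants p M) ∧ Nat.card (coinvariants p M) = p ^ eulerExp p M := by
  obtain ⟨hfin, hfin', hcard⟩ := card_coinvariants_of_lengthAt_eq_zero M hM
    (lengthAt_primeT_eq_zero_of_constantCoeff_ne_zero M hM f hf h0)
  refine ⟨hfin', ?_⟩
  rw [hcard, hnf _ hfin]
  simp

/-- **`v_p(f(0)) = e(X)`**: the constant coefficient of a characteristic power series with
`f(0) ≠ 0` is `U · p^{e(X)}`, `U ∈ ℤ_pˣ` (tree `coeff_lengthAt_charGenerator_eq_unit_mul_pow` at
`ℓ_{(T)} = 0`). [cite: Washington1997, §13.2] -/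
theorem valuation_constantCoeff_eq_eulerExp (hM : Module.IsTorsion (IwasawaAlgebra p) M)
    (f : IwasawaAlgebra p) (hf : Module.charIdeal (IwasawaAlgebra p) M = Ideal.span {f})
    (h0 : PowerSeries.constantCoeff f ≠ 0) :
    (PowerSeries.constantCoeff f).valuation = eulerExp p M := by
  obtain ⟨U, hU⟩ := coeff_lengthAt_charGenerator_eq_unit_mul_pow p M hM f hf
  rw [lengthAt_primeT_eq_zero_of_constantCoeff_ne_zero M hM f hf h0, ENat.toNat_zero,
    PowerSeries.coeff_zero_eq_constantCoeff_apply] at hU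
  have hp : Nat.Prime p := Fact.out
  have hU0 : (U : ℤ_[p]) ≠ 0 := U.ne_zero
  have hpe : (p : ℤ_[p]) ^ eulerExp p M ≠ 0 := pow_ne_zero _ (by exact_mod_cast hp.ne_zero)
  rw [hU, PadicInt.valuation_mul hU0 hpe, PadicInt.valuation_pow, PadicInt.valuation_p, mul_one]
  have hUv : (U : ℤ_[p]).valuation = 0 := by
    have h1 := PadicInt.norm_units U
    rw [PadicInt.norm_eq_zpow_neg_valuation hU0] at h1
    have hp1 : (1 : ℝ) < p := by exact_mod_cast hp.one_lt
    have := zpow_right_injective₀ (by positivity) hp1.ne' (h1.trans (zpow_zero (p : ℝ)).symm)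
    omega
  rw [hUv, zero_add]

/-! ## §3. LEMMA M₀: `#(X/𝔪X) ≤ p^{v_p(f(0))}` and `X` needs at most `v_p(f(0))` generators -/

omit [Module.Finite (IwasawaAlgebra p) M] in
/-- `TX ≤ 𝔪X` (`T` is not a unit of the local ring `Λ`, so `(T) ≤ 𝔪`). [folklore] -/
theorem TSubmodule_le_maximalIdeal_smul_top :
    TSubmodule p M ≤ maximalIdeal (IwasawaAlgebra p) • (⊤ : Submodule (IwasawaAlgebra p) M) :=
  Submodule.smul_mono_left ((Ideal.span_singleton_le_iff_mem _).mpr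
    ((IsLocalRing.mem_maximalIdeal _).mpr (not_isUnit_X p)))

/-- **LEMMA M₀ (count form): `#(X/𝔪X) ≤ p^{v_p(f(0))}`** for `X` finitely generated torsion over
`Λ = ℤ_p⟦T⟧` WITHOUT nonzero finite `Λ`-submodules, `char(X) = (f)`, `f(0) ≠ 0` (`𝔪 = (p, T)`;
`X/𝔪X` is a quotient of `X/TX`, which has exactly `p^{v_p(f(0))}` elements). The layer-0 case of
LEMMA (M) of X1R0-GAPMAP §21.1 with the weight `v_p(f(0)) ≥ ord_𝔪(f)`.
[cite: GreenbergLNM1716, §4 Lemma 4.2, p. 137] -/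
theorem natCard_quotient_maximalIdeal_le (hM : Module.IsTorsion (IwasawaAlgebra p) M)
    (hnf : ∀ N : Submodule (IwasawaAlgebra p) M, Finite N → N = ⊥) (f : IwasawaAlgebra p)
    (hf : Module.charIdeal (IwasawaAlgebra p) M = Ideal.span {f})
    (h0 : PowerSeries.constantCoeff f ≠ 0) :
    Finite (M ⧸ maximalIdeal (IwasawaAlgebra p) • (⊤ : Submodule (IwasawaAlgebra p) M)) ∧
    Nat.card (M ⧸ maximalIdeal (IwasawaAlgebra p) • (⊤ : Submodule (IwasawaAlgebra p) M)) ≤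
      p ^ (PowerSeries.constantCoeff f).valuation := by
  obtain ⟨hfin, hcard⟩ := natCard_coinvariants_eq M hM hnf f hf h0
  have hsurj := Submodule.factor_surjective (TSubmodule_le_maximalIdeal_smul_top (p := p) M)
  haveI : Finite (coinvariants p M) := hfin
  refine ⟨Finite.of_surjective _ hsurj, ?_⟩
  rw [valuation_constantCoeff_eq_eulerExp M hM f hf h0, ← hcard]
  exact Nat.card_le_card_of_surjective _ hsurj

/-- `#(Λ/𝔪) = p`: the residue field of `Λ = ℤ_p⟦T⟧` is `𝔽_p` (`𝔪` is the kernel of the surjection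
`Λ → ℤ_p → ℤ/p`). [folklore] -/
theorem natCard_residueField : Nat.card (ResidueField (IwasawaAlgebra p)) = p := by
  let g : IwasawaAlgebra p →+* ZMod p :=
    (PadicInt.toZMod (p := p)).comp (PowerSeries.constantCoeff (R := ℤ_[p]))
  have hg : Function.Surjective g := ZMod.ringHom_surjective g
  have hker : RingHom.ker g = maximalIdeal (IwasawaAlgebra p) :=
    IsLocalRing.eq_maximalIdeal (RingHom.ker_isMaximal_of_surjective g hg)
  have e : ResidueField (IwasawaAlgebra p) ≃+* ZMod p :=
    (Ideal.quotEquivOfEq hker.symm).trans (RingHom.quotientKerEquivOfSurjective hg)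
  rw [Nat.card_congr e.toEquiv, Nat.card_zmod]

/-- **LEMMA M₀ (generator form): `X` is generated by at most `v_p(f(0))` elements** under the same
hypotheses (an `𝔽_p`-basis of `X/𝔪X` has `≤ v_p(f(0))` vectors by the count form and
`#Λ/𝔪 = p`; lift it and apply Nakayama over the local ring `Λ`, `IsLocalRing.map_mkQ_eq_top`).
[cite: GreenbergLNM1716, §4 Lemma 4.2, p. 137] -/
theorem exists_finset_span_eq_top_card_le (hM : Module.IsTorsion (IwasawaAlgebra p) M)
    (hnf : ∀ N : Submodule (IwasawaAlgebra p) M, Finite N → N = ⊥) (f : IwasawaAlgebra p)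
    (hf : Module.charIdeal (IwasawaAlgebra p) M = Ideal.span {f})
    (h0 : PowerSeries.constantCoeff f ≠ 0) :
    ∃ S : Finset M, Submodule.span (IwasawaAlgebra p) (S : Set M) = ⊤ ∧
      S.card ≤ (PowerSeries.constantCoeff f).valuation := by
  obtain ⟨hfin, hcard⟩ := natCard_quotient_maximalIdeal_le M hM hnf f hf h0
  -- `X/𝔪X` as a vector space over `k = Λ/𝔪`
  letI : Module (ResidueField (IwasawaAlgebra p))
      (M ⧸ maximalIdeal (IwasawaAlgebra p) • (⊤ : Submodule (IwasawaAlgebra p) M)) :=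
    inferInstanceAs (Module (IwasawaAlgebra p ⧸ maximalIdeal (IwasawaAlgebra p))
      (M ⧸ maximalIdeal (IwasawaAlgebra p) • (⊤ : Submodule (IwasawaAlgebra p) M)))
  haveI : IsScalarTower (IwasawaAlgebra p) (ResidueField (IwasawaAlgebra p))
      (M ⧸ maximalIdeal (IwasawaAlgebra p) • (⊤ : Submodule (IwasawaAlgebra p) M)) :=
    inferInstanceAs (IsScalarTower (IwasawaAlgebra p)
      (IwasawaAlgebra p ⧸ maximalIdeal (IwasawaAlgebra p))
      (M ⧸ maximalIdeal (IwasawaAlgebra p) • (⊤ : Submodule (IwasawaAlgebra p) M)))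
  haveI : Finite (M ⧸ maximalIdeal (IwasawaAlgebra p) • (⊤ : Submodule (IwasawaAlgebra p) M)) :=
    hfin
  haveI : Module.Finite (ResidueField (IwasawaAlgebra p))
      (M ⧸ maximalIdeal (IwasawaAlgebra p) • (⊤ : Submodule (IwasawaAlgebra p) M)) :=
    Module.Finite.of_finite
  have hp : Nat.Prime p := Fact.out
  -- `p^d = #(X/𝔪X) ≤ p^{v_p(f(0))}`
  have hcardQ : Nat.card (M ⧸ maximalIdeal (IwasawaAlgebra p) • (⊤ : Submodule (IwasawaAlgebra p) M))
      = p ^ Module.finrank (ResidueField (IwasawaAlgebra p))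
          (M ⧸ maximalIdeal (IwasawaAlgebra p) • (⊤ : Submodule (IwasawaAlgebra p) M)) := by
    rw [Module.natCard_eq_pow_finrank (K := ResidueField (IwasawaAlgebra p))
      (V := M ⧸ maximalIdeal (IwasawaAlgebra p) • (⊤ : Submodule (IwasawaAlgebra p) M)),
      natCard_residueField]
  have hdle : Module.finrank (ResidueField (IwasawaAlgebra p))
      (M ⧸ maximalIdeal (IwasawaAlgebra p) • (⊤ : Submodule (IwasawaAlgebra p) M)) ≤
      (PowerSeries.constantCoeff f).valuation :=
    (Nat.pow_le_pow_iff_right hp.one_lt).mp (hcardQ ▸ hcard)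
  -- a basis of `X/𝔪X`, lifted to `X`; Nakayama
  let b := Module.finBasis (ResidueField (IwasawaAlgebra p))
    (M ⧸ maximalIdeal (IwasawaAlgebra p) • (⊤ : Submodule (IwasawaAlgebra p) M))
  choose m hm using fun i ↦
    Submodule.Quotient.mk_surjective (maximalIdeal (IwasawaAlgebra p) • ⊤) (b i)
  refine ⟨Finset.univ.image m, ?_, ?_⟩
  · rw [Finset.coe_image, Finset.coe_univ, Set.image_univ, ← IsLocalRing.map_mkQ_eq_top,
      Submodule.map_span, ← Set.range_comp]
    have hrange : ((maximalIdeal (IwasawaAlgebra p) •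
        (⊤ : Submodule (IwasawaAlgebra p) M)).mkQ ∘ m) = fun i ↦ b i := by
      funext i
      exact hm i
    rw [hrange, ← Submodule.restrictScalars_span (IwasawaAlgebra p)
      (ResidueField (IwasawaAlgebra p)) Ideal.Quotient.mk_surjective,
      Submodule.restrictScalars_eq_top_iff, b.span_eq]
  · exact (Finset.card_image_le.trans (by simp)).trans hdle

end Summit.BirchSwinnertonDyer.Rank1Residual.X1.GeneratorBound

end
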